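import Summits.CriticalPhenomena.PercolationContinuityZ3.Theorems.PercNearOneGluingNoHeavyConstsMDLXJointXEdgeInduction
import HarnessLib

/-!
# CROSS at the reach marker `u = z`, marker-pinned class: the member `M₁ ≥ 0` on `{U ⊆ {s↔y}}` from three exchange inequalities
# (PAPER-2 track (ii), seat `prim-consts-2`, gen 21 — companion of `…ConstsCrossReachMarkerPinned.lean`, which does `M₂`)

builds on p205010 (kernel theorem, internal audit signed; external expert review pending).  Support file (`--supports
stmt-CriticalPhenomena-4575`); theorems only, no sorries, standard axioms.  Memo `run/shared/lean/prim/consts/FROM-prim-consts-2-g21-GIBBS-ORBIT.md` §3.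

Notation as in `…ConstsCrossReachMarkerPinned.lean`: `D = {s ↮ X}`, `D' = D ∖ Z`, `Y = {s↔y}`, `Z = {s↔z}`, `W = {y↔z}`, `N = D ∖ Y`,
`T = {y ↮ {s}∪X} ∩ D`, `T' = {y ↮ {s,z}∪X} ∩ D'`, `E₁ = {{s,y} ↮ X}`, `Q = {y ↔ X}`; `F = 1_U`, `U = {V(C_s) ∈ 𝒰}` with `𝒰` monotone and
`𝒰 S → y ∈ S`.  The OTHER member of `Consts.CrossRel` at `u = z`,
`M₁ = P(X',X,X) + P(X,X',X) + P(X,X,X') = μ(T')·cov_D(F;Z) + μ(T)·[μ(D')∫_{D∩Z}F − ∫_{D'}F·μ(D∩Z)] − μ(T∩W)·[μ(D')∫_{D∩Y}F − ∫_{D'}F·μ(D∩Y)]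
 − μ(T∩W)·[μ(D)∫_{D'∩Y}F − ∫_D F·μ(D'∩Y)]` (the `X'`-slots kill `{s↔z}` and `{y↔z}`), is on this class EXACTLY
  `M₁ = (2μ(N∩Q∖Z) + μ(T∩W))·G_a + (2μ(T') + μ(T∩W))·G_c + 2μ(D∩Y∩U∖Z)·G₅ + μ(T∩Z)·G_e`   (a `ring` identity in nine atoms), with
  `G_a = μ(T')·μ(D∩Y∩U) − μ(D∩Y∩U∖Z)·μ(T)`                 (exchange `(D∩Y∩U∖Z) × T → T' × (D∩Y∩U)`, sources `{s,y}`),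
  `G_c = μ(E₁∖Z∖W∖U)·μ(D∩Y∩U) − μ(D∩Y∩U∖Z)·μ(E₁∖U)`       (exchange `(D∩Y∩U∖Z) × (E₁∖U) → (E₁∖U∖Z∖W) × (D∩Y∩U)`, sources `{s,y}`),
  `G_e = μ(D∖Z∖U)·μ(D∩Y∩Z∩U) − μ(D∩Y∩U∖Z)·μ(D∩Z∖U)`       (exchange across the source sets `{s,y}` / `{s}`),
  `G₅ = μ(T∩Z)·μ(N) − μ(N∩Z)·μ(T)`                         (van den Berg–Häggström–Kahn Thm 1.4 with sets, proved here),
the certificate of the seat's LP (kit j198953, class `UsubY:M1z`, weights 2,2,2,2,1,1,1), re-verified exactly this gen (0/300 failures; every generator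
`≥ 0`).  The three exchanges (instances of `Consts.localEv_fourEvents`) enter as HYPOTHESES `hGa hGc hGe` (discharged in `…MarkerPinnedExchanges.lean`).
* `Consts.crossRel_reach_M1_of_markerPinned_of_exchanges` — **THEOREM: `hGa ∧ hGc ∧ hGe ⟹ P(X',X,X) + P(X,X',X) + P(X,X,X') ≥ 0`** (`X' = X ∪ {z}`); with the
  companion (`M₂`) and `…ConstsCrossReach.lean` (`U ⊆ Z`, `U ⊇ Z`) both `u = z` members of `Consts.CrossRel` are settled on three of the four pinned quadrants.
[cite: VandenbergHaggstromKahn2005, Thm. 1.4 (p. 7) with Remark 1 after Thm. 1.2 (p. 5); Thm. 1.1 (pp. 3–5)]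
-/

noncomputable section

namespace Summit.CriticalPhenomena.PercolationContinuityZ3.Theorems

open MeasureTheory Set Literature.Probability.LatticeModels Literature.Probability.Percolation
open scoped Classical

namespace Consts

variable {V : Type*} [Fintype V]

omit [Fintype V] in
/-- `{s ↮ X ∪ {z}} = {s ↮ X} ∖ {s ↔ z}`. [folklore] -/
private theorem avoid_insert_eq_diff'' (s z : V) (X : Set V) :
    {ω : BondConfig V | ∀ x ∈ insert z X, ¬ (openGraph ω).Reachable s x} =
      {ω : BondConfig V | ∀ x ∈ X, ¬ (openGraph ω).Reachable s x} \ openConn s z := by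
  ext ω; simp only [mem_setOf_eq, forall_mem_insert, mem_sdiff, openConn]; tauto

omit [Fintype V] in
/-- The copy-0 event of the `X ∪ {z}`-slot is disjoint from `{y ↔ z}`. [folklore] -/
private theorem avoidY_insert_inter_conn_eq_empty'' (s y z : V) (X : Set V) (S : Set (BondConfig V)) :
    {ω : BondConfig V | ∀ x ∈ insert s (insert z X), ¬ (openGraph ω).Reachable y x} ∩ S ∩ openConn y z = ∅ := by
  refine Set.eq_empty_of_forall_notMem fun ω hω => ?_
  exact hω.1.1 z (mem_insert_of_mem s (mem_insert z X)) hω.2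

omit [Fintype V] in
/-- The nine-atom algebra of `M₁` on the marker-pinned class (module docstring). [folklore] -/
theorem markerPinned_M1_algebra (b aZ yZu yzu TZ tw tp q1 Q23 : ℝ) :
    tp * ((b + aZ + (yZu + yzu) + (q1 + Q23 + (TZ + (tw + tp)))) * b - (b + aZ) * (b + yZu + (q1 + TZ))) -
          0 * ((b + aZ + (yZu + yzu) + (q1 + Q23 + (TZ + (tw + tp)))) * (b + aZ) - (b + aZ) * (b + aZ + (yZu + yzu))) +
        ((TZ + (tw + tp)) * ((aZ + yzu + tw + tp + Q23) * b - aZ * (b + yZu + (q1 + TZ))) -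
          tw * ((aZ + yzu + tw + tp + Q23) * (b + aZ) - aZ * (b + aZ + (yZu + yzu)))) +
      ((TZ + (tw + tp)) * ((b + aZ + (yZu + yzu) + (q1 + Q23 + (TZ + (tw + tp)))) * 0 - (b + aZ) * 0) -
          tw * ((b + aZ + (yZu + yzu) + (q1 + Q23 + (TZ + (tw + tp)))) * aZ - (b + aZ) * (aZ + yzu))) =
      (2 * Q23 + tw) * (tp * (b + aZ) - aZ * (TZ + tw + tp)) +
        (2 * tp + tw) * ((yzu + tp) * (b + aZ) - aZ * (yZu + yzu + TZ + tw + tp)) +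
        2 * aZ * (TZ * (TZ + tw + tp + q1 + Q23) - (TZ + q1) * (TZ + tw + tp)) +
        TZ * ((yzu + tw + tp + Q23) * b - aZ * (yZu + TZ + q1)) := by
  ring

/-- **CROSS member `M₁` at `u = z` on the marker-pinned class, from three exchange inequalities** (module docstring; `G₅ ≥ 0` =
BHK Thm 1.4 with sets is proved inside). [cite: VandenbergHaggstromKahn2005, Thm. 1.4 (p. 7) with Remark 1 after Thm. 1.2 (p. 5)] -/
theorem crossRel_reach_M1_of_markerPinned_of_exchanges (w : Sym2 V → unitInterval) (s y z : V) (X : Set V)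
    {𝒰 : Set V → Prop} (h𝒰y : ∀ S : Set V, 𝒰 S → y ∈ S)
    (F : Set (Sym2 V) → ℝ) (hF : ∀ ω : BondConfig V, F (openEdgeCluster ω s) = if 𝒰 {v | (openGraph ω).Reachable s v} then 1 else 0)
    (hGa : (prodBernoulli w).real (({ω : BondConfig V | ∀ x ∈ X, ¬ (openGraph ω).Reachable s x} ∩ openConn s y ∩
            {ω | 𝒰 {v | (openGraph ω).Reachable s v}}) \ openConn s z) *
        (prodBernoulli w).real ({ω : BondConfig V | ∀ x ∈ insert s X, ¬ (openGraph ω).Reachable y x} ∩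
            {ω | ∀ x ∈ X, ¬ (openGraph ω).Reachable s x}) ≤
      (prodBernoulli w).real ({ω : BondConfig V | ∀ x ∈ insert s (insert z X), ¬ (openGraph ω).Reachable y x} ∩
            {ω | ∀ x ∈ insert z X, ¬ (openGraph ω).Reachable s x}) *
        (prodBernoulli w).real ({ω : BondConfig V | ∀ x ∈ X, ¬ (openGraph ω).Reachable s x} ∩ openConn s y ∩
            {ω | 𝒰 {v | (openGraph ω).Reachable s v}}))
    (hGc : (prodBernoulli w).real (({ω : BondConfig V | ∀ x ∈ X, ¬ (openGraph ω).Reachable s x} ∩ openConn s y ∩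
            {ω | 𝒰 {v | (openGraph ω).Reachable s v}}) \ openConn s z) *
        (prodBernoulli w).real (({ω : BondConfig V | ∀ x ∈ X, ¬ (openGraph ω).Reachable y x} ∩
            {ω | ∀ x ∈ X, ¬ (openGraph ω).Reachable s x}) \ {ω | 𝒰 {v | (openGraph ω).Reachable s v}}) ≤
      (prodBernoulli w).real (((({ω : BondConfig V | ∀ x ∈ X, ¬ (openGraph ω).Reachable y x} ∩
            {ω | ∀ x ∈ X, ¬ (openGraph ω).Reachable s x}) \ {ω | 𝒰 {v | (openGraph ω).Reachable s v}}) \ openConn s z) \ openConn y z) *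
        (prodBernoulli w).real ({ω : BondConfig V | ∀ x ∈ X, ¬ (openGraph ω).Reachable s x} ∩ openConn s y ∩
            {ω | 𝒰 {v | (openGraph ω).Reachable s v}}))
    (hGe : (prodBernoulli w).real (({ω : BondConfig V | ∀ x ∈ X, ¬ (openGraph ω).Reachable s x} ∩ openConn s y ∩
            {ω | 𝒰 {v | (openGraph ω).Reachable s v}}) \ openConn s z) *
        (prodBernoulli w).real (({ω : BondConfig V | ∀ x ∈ X, ¬ (openGraph ω).Reachable s x} ∩ openConn s z) \
            {ω | 𝒰 {v | (openGraph ω).Reachable s v}}) ≤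
      (prodBernoulli w).real (({ω : BondConfig V | ∀ x ∈ X, ¬ (openGraph ω).Reachable s x} \ openConn s z) \
            {ω | 𝒰 {v | (openGraph ω).Reachable s v}}) *
        (prodBernoulli w).real ({ω : BondConfig V | ∀ x ∈ X, ¬ (openGraph ω).Reachable s x} ∩ openConn s y ∩
            {ω | 𝒰 {v | (openGraph ω).Reachable s v}} ∩ openConn s z)) :
    0 ≤ polMargin (prodBernoulli w) s y z F (insert z X) X X +
          polMargin (prodBernoulli w) s y z F X (insert z X) X +
        polMargin (prodBernoulli w) s y z F X X (insert z X) := by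
  classical
  set μ := prodBernoulli w with hμ
  -- degenerate case `z = s`
  by_cases hzs : z = s
  · subst hzs
    have h0 : ∀ X₁ X₂ : Set V, polMargin μ z y z F (insert z X) X₁ X₂ = 0 := fun X₁ X₂ =>
      polMargin_eq_zero_of_slot0 μ z y z F _ X₁ X₂ (Or.inl (mem_insert z X))
    have h1 : ∀ X₀ X₂ : Set V, polMargin μ z y z F X₀ (insert z X) X₂ = 0 := fun X₀ X₂ =>
      polMargin_eq_zero_of_slot1 μ z y z F X₀ _ X₂ (mem_insert z X)
    have h2 : ∀ X₀ X₁ : Set V, polMargin μ z y z F X₀ X₁ (insert z X) = 0 := fun X₀ X₁ =>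
      polMargin_eq_zero_of_slot2 μ z y z F X₀ X₁ _ (mem_insert z X)
    rw [h0, h1, h2]; norm_num
  have hmeas : ∀ S : Set (BondConfig V), MeasurableSet S := fun _ => MeasurableSet.of_discrete
  -- the events
  set D : Set (BondConfig V) := {ω | ∀ x ∈ X, ¬ (openGraph ω).Reachable s x} with hD
  set D' : Set (BondConfig V) := {ω | ∀ x ∈ insert z X, ¬ (openGraph ω).Reachable s x} with hD'
  set A : Set (BondConfig V) := {ω | ∀ x ∈ insert s X, ¬ (openGraph ω).Reachable y x} with hA
  set A' : Set (BondConfig V) := {ω | ∀ x ∈ insert s (insert z X), ¬ (openGraph ω).Reachable y x} with hA'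
  set A₀ : Set (BondConfig V) := {ω | ∀ x ∈ X, ¬ (openGraph ω).Reachable y x} with hA₀
  set Yv : Set (BondConfig V) := openConn s y with hYv
  set Zv : Set (BondConfig V) := openConn s z with hZv
  set Wv : Set (BondConfig V) := openConn y z with hWv
  set U : Set (BondConfig V) := {ω | 𝒰 {v | (openGraph ω).Reachable s v}} with hU
  set Gy : Set (BondConfig V) := {ω | ∃ x ∈ X, (openGraph ω).Reachable y x} with hGy
  set N : Set (BondConfig V) := {ω | ∀ a ∈ ({s} : Set V), ∀ t ∈ insert y X, ¬ (openGraph ω).Reachable a t} with hN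
  have mD : ∀ ω, ω ∈ D ↔ ∀ x ∈ X, ¬ (openGraph ω).Reachable s x := fun ω => Iff.rfl
  have mD' : ∀ ω, ω ∈ D' ↔ ¬ (openGraph ω).Reachable s z ∧ ∀ x ∈ X, ¬ (openGraph ω).Reachable s x := fun ω => by
    simp only [hD', mem_setOf_eq, forall_mem_insert]
  have mA : ∀ ω, ω ∈ A ↔ ¬ (openGraph ω).Reachable y s ∧ ∀ x ∈ X, ¬ (openGraph ω).Reachable y x := fun ω => by
    simp only [hA, mem_setOf_eq, forall_mem_insert]
  have mA' : ∀ ω, ω ∈ A' ↔ ¬ (openGraph ω).Reachable y s ∧ ¬ (openGraph ω).Reachable y z ∧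
      ∀ x ∈ X, ¬ (openGraph ω).Reachable y x := fun ω => by
    simp only [hA', mem_setOf_eq, forall_mem_insert]
  have mA₀ : ∀ ω, ω ∈ A₀ ↔ ∀ x ∈ X, ¬ (openGraph ω).Reachable y x := fun ω => Iff.rfl
  have mY : ∀ ω, ω ∈ Yv ↔ (openGraph ω).Reachable s y := fun ω => Iff.rfl
  have mZ : ∀ ω, ω ∈ Zv ↔ (openGraph ω).Reachable s z := fun ω => Iff.rfl
  have mW : ∀ ω, ω ∈ Wv ↔ (openGraph ω).Reachable y z := fun ω => Iff.rfl
  have mGy : ∀ ω, ω ∈ Gy ↔ ∃ x ∈ X, (openGraph ω).Reachable y x := fun ω => Iff.rfl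
  have mN : ∀ ω, ω ∈ N ↔ ¬ (openGraph ω).Reachable s y ∧ ∀ x ∈ X, ¬ (openGraph ω).Reachable s x := fun ω => by
    simp only [hN, mem_setOf_eq, mem_singleton_iff, forall_eq, forall_mem_insert]
  -- `U ⊆ Y`
  have hUY : ∀ ω, ω ∈ U → (openGraph ω).Reachable s y := fun ω hω => h𝒰y _ hω
  -- the functional on clusters is the indicator of `U`
  have hFU : ∀ ω : BondConfig V, F (openEdgeCluster ω s) = U.indicator 1 ω := by
    intro ω
    rw [hF ω]
    by_cases h : 𝒰 {v | (openGraph ω).Reachable s v}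
    · rw [if_pos h, indicator_of_mem (show ω ∈ U from h), Pi.one_apply]
    · rw [if_neg h, indicator_of_notMem (show ω ∉ U from h)]
  have hI : ∀ S : Set (BondConfig V), ∫ ω in S, F (openEdgeCluster ω s) ∂μ = μ.real (S ∩ U) := by
    intro S
    simp_rw [hFU]
    exact TripodExchange.setIntegral_indicator_one_eq w S U
  -- set identities
  have sD' : D' = D \ Zv := avoid_insert_eq_diff'' s z X
  have sD'Z : D' ∩ Zv = ∅ := by rw [sD']; exact Set.sdiff_inter_self
  have sD'ZU : D' ∩ Zv ∩ U = ∅ := by rw [sD'Z, Set.empty_inter]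
  have sA'W : A' ∩ D' ∩ Wv = ∅ := avoidY_insert_inter_conn_eq_empty'' s y z X D'
  have sD'U : D' ∩ U = (D ∩ Yv ∩ U) \ Zv := by
    ext ω; simp only [mem_inter_iff, mem_sdiff, mD', mD, mY]
    constructor
    · rintro ⟨⟨hsz, hsX⟩, hu⟩; exact ⟨⟨⟨hsX, hUY ω hu⟩, hu⟩, hsz⟩
    · rintro ⟨⟨⟨hsX, -⟩, hu⟩, hsz⟩; exact ⟨⟨hsz, hsX⟩, hu⟩
  have sD'YU : D' ∩ Yv ∩ U = (D ∩ Yv ∩ U) \ Zv := by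
    ext ω; simp only [mem_inter_iff, mem_sdiff, mD', mD]; tauto
  have sDZU : D ∩ Zv ∩ U = D ∩ Yv ∩ U ∩ Zv := by
    ext ω; simp only [mem_inter_iff, mY]
    constructor
    · rintro ⟨⟨hd, hz⟩, hu⟩; exact ⟨⟨⟨hd, hUY ω hu⟩, hu⟩, hz⟩
    · rintro ⟨⟨⟨hd, -⟩, hu⟩, hz⟩; exact ⟨⟨hd, hz⟩, hu⟩
  have sD'Y : D' ∩ Yv = (D ∩ Yv) \ Zv := by
    ext ω; simp only [mem_inter_iff, mem_sdiff, mD', mD]; tauto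
  -- `T ∩ W ⊆ Zᶜ`: y↔z and s↔z would give s↔y
  have hTWZ : ∀ ω, ω ∈ A ∩ D ∩ Wv → ω ∉ Zv := by
    rintro ω ⟨⟨ha, -⟩, hw⟩ hz
    rw [mA] at ha
    exact ha.1 ((show (openGraph ω).Reachable y z from hw).trans (show (openGraph ω).Reachable s z from hz).symm)
  have sTdW : ((A ∩ D) \ Zv) ∩ Wv = A ∩ D ∩ Wv := by
    ext ω; simp only [mem_inter_iff, mem_sdiff]
    constructor
    · rintro ⟨⟨had, -⟩, hw⟩; exact ⟨had, hw⟩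
    · rintro ⟨had, hw⟩; exact ⟨⟨had, hTWZ ω ⟨had, hw⟩⟩, hw⟩
  have sT' : ((A ∩ D) \ Zv) \ Wv = A' ∩ D' := by
    ext ω; simp only [mem_inter_iff, mem_sdiff, mA, mD, mA', mD', mZ, mW]; tauto
  have sTzwZ : A ∩ D ∩ (Zv ∪ Wv) ∩ Zv = A ∩ D ∩ Zv := by
    ext ω; simp only [mem_inter_iff, mem_union]; tauto
  have sTzwW : (A ∩ D ∩ (Zv ∪ Wv)) \ Zv = A ∩ D ∩ Wv := by
    ext ω; simp only [mem_inter_iff, mem_union, mem_sdiff]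
    constructor
    · rintro ⟨⟨had, hzw⟩, hz⟩; exact ⟨had, hzw.resolve_left hz⟩
    · rintro ⟨had, hw⟩; exact ⟨⟨had, Or.inr hw⟩, hTWZ ω ⟨had, hw⟩⟩
  -- `E₁ = A₀ ∩ D` splits along `Y` into `D ∩ Y` and `T = A ∩ D`
  have sE₁Y : A₀ ∩ D ∩ Yv = D ∩ Yv := by
    ext ω; simp only [mem_inter_iff, mA₀, mD, mY]
    constructor
    · rintro ⟨⟨-, hd⟩, hy⟩; exact ⟨hd, hy⟩
    · rintro ⟨hd, hy⟩; exact ⟨⟨fun x hx hyx => hd x hx (hy.trans hyx), hd⟩, hy⟩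
  have sE₁N : (A₀ ∩ D) \ Yv = A ∩ D := by
    ext ω; simp only [mem_inter_iff, mem_sdiff, mA₀, mD, mA, mY]
    constructor
    · rintro ⟨⟨ha, hd⟩, hy⟩; exact ⟨⟨fun h => hy h.symm, ha⟩, hd⟩
    · rintro ⟨⟨hys, ha⟩, hd⟩; exact ⟨⟨ha, hd⟩, fun h => hys h.symm⟩
  have sE₁zY : A₀ ∩ D ∩ (Zv ∪ Wv) ∩ Yv = (D ∩ Yv) ∩ Zv := by
    ext ω; simp only [mem_inter_iff, mem_union, mA₀, mD, mY, mZ, mW]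
    constructor
    · rintro ⟨⟨⟨-, hd⟩, hzw⟩, hy⟩; exact ⟨⟨hd, hy⟩, hzw.elim id fun hyz => hy.trans hyz⟩
    · rintro ⟨⟨hd, hy⟩, hz⟩; exact ⟨⟨⟨fun x hx hyx => hd x hx (hy.trans hyx), hd⟩, Or.inl hz⟩, hy⟩
  have sE₁zN : (A₀ ∩ D ∩ (Zv ∪ Wv)) \ Yv = A ∩ D ∩ (Zv ∪ Wv) := by
    ext ω; simp only [mem_inter_iff, mem_union, mem_sdiff, mA₀, mD, mA, mY]
    constructor
    · rintro ⟨⟨⟨ha, hd⟩, hzw⟩, hy⟩; exact ⟨⟨⟨fun h => hy h.symm, ha⟩, hd⟩, hzw⟩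
    · rintro ⟨⟨⟨hys, ha⟩, hd⟩, hzw⟩; exact ⟨⟨⟨ha, hd⟩, hzw⟩, fun h => hys h.symm⟩
  -- `N = D ∖ Y` splits along `Gy = {y ↔ X}` into `T` and `N ∩ Gy`
  have sDN : D \ Yv = N := by
    ext ω; simp only [mem_sdiff, mD, mN, mY]; tauto
  have sNT : N \ Gy = A ∩ D := by
    ext ω; simp only [mem_sdiff, mN, mGy, mem_inter_iff, mA, mD, not_exists, not_and]
    constructor
    · rintro ⟨⟨hsy, hsX⟩, hg⟩; exact ⟨⟨fun h => hsy h.symm, hg⟩, hsX⟩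
    · rintro ⟨⟨hys, hg⟩, hsX⟩; exact ⟨⟨fun h => hys h.symm, hsX⟩, hg⟩
  have sNZT : (N ∩ Zv) \ Gy = A ∩ D ∩ Zv := by
    rw [Set.sdiff_eq, inter_right_comm, ← Set.sdiff_eq, sNT]
  have sNZG : N ∩ (Zv ∩ Gy) = N ∩ Zv ∩ Gy := (inter_assoc N Zv Gy).symm
  have sNGZ : N ∩ Gy ∩ Zv = N ∩ Zv ∩ Gy := inter_right_comm N Gy Zv
  have sDZN : (D ∩ Zv) \ Yv = N ∩ Zv := by
    rw [Set.sdiff_eq, inter_right_comm, ← Set.sdiff_eq, sDN]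
  have sDYZu : (D ∩ Yv ∩ Zv) \ U = ((D ∩ Yv) \ U) ∩ Zv := by
    ext ω; simp only [mem_inter_iff, mem_sdiff]; tauto
  have sDYUZ : D ∩ Yv ∩ U ∩ Zv = (D ∩ Yv ∩ Zv) ∩ U := inter_right_comm (D ∩ Yv) U Zv
  -- the nine atoms
  set b := μ.real (D ∩ Yv ∩ U ∩ Zv) with hb
  set aZ := μ.real ((D ∩ Yv ∩ U) \ Zv) with haZ
  set yZu := μ.real (((D ∩ Yv) \ U) ∩ Zv) with hyZu
  set yzu := μ.real (((D ∩ Yv) \ U) \ Zv) with hyzu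
  set TZ := μ.real (A ∩ D ∩ Zv) with hTZ
  set tw := μ.real (A ∩ D ∩ Wv) with htw
  set tp := μ.real (A' ∩ D') with htp
  set q1 := μ.real (N ∩ Zv ∩ Gy) with hq1
  set Q23 := μ.real ((N ∩ Gy) \ Zv) with hQ23
  have h0 : ∀ S : Set (BondConfig V), 0 ≤ μ.real S := fun _ => measureReal_nonneg
  -- two-block splits
  have r1 : μ.real (D ∩ Yv ∩ U) = b + aZ := by
    have h := measureReal_inter_add_sdiff (μ := μ) (s := D ∩ Yv ∩ U) (hmeas Zv); linarith
  have r2 : μ.real ((D ∩ Yv) \ U) = yZu + yzu := by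
    have h := measureReal_inter_add_sdiff (μ := μ) (s := (D ∩ Yv) \ U) (hmeas Zv); linarith
  have r3 : μ.real (D ∩ Yv) = b + aZ + (yZu + yzu) := by
    have h := measureReal_inter_add_sdiff (μ := μ) (s := D ∩ Yv) (hmeas U); rw [r1, r2] at h; linarith
  have r4 : μ.real (D ∩ Yv ∩ Zv) = b + yZu := by
    have h := measureReal_inter_add_sdiff (μ := μ) (s := D ∩ Yv ∩ Zv) (hmeas U)
    rw [← sDYUZ, sDYZu] at h; linarith
  have r5 : μ.real ((A ∩ D) \ Zv) = tw + tp := by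
    have h := measureReal_inter_add_sdiff (μ := μ) (s := (A ∩ D) \ Zv) (hmeas Wv)
    rw [sTdW, sT'] at h; linarith
  have r6 : μ.real (A ∩ D) = TZ + (tw + tp) := by
    have h := measureReal_inter_add_sdiff (μ := μ) (s := A ∩ D) (hmeas Zv); rw [r5] at h; linarith
  have r7 : μ.real (A ∩ D ∩ (Zv ∪ Wv)) = TZ + tw := by
    have h := measureReal_inter_add_sdiff (μ := μ) (s := A ∩ D ∩ (Zv ∪ Wv)) (hmeas Zv)
    rw [sTzwZ, sTzwW] at h; linarith
  have r8 : μ.real (A₀ ∩ D) = (b + aZ + (yZu + yzu)) + (TZ + (tw + tp)) := by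
    have h := measureReal_inter_add_sdiff (μ := μ) (s := A₀ ∩ D) (hmeas Yv)
    rw [sE₁Y, sE₁N, r3, r6] at h; linarith
  have r9 : μ.real (A₀ ∩ D ∩ (Zv ∪ Wv)) = (b + yZu) + (TZ + tw) := by
    have h := measureReal_inter_add_sdiff (μ := μ) (s := A₀ ∩ D ∩ (Zv ∪ Wv)) (hmeas Yv)
    rw [sE₁zY, sE₁zN, r4, r7] at h; linarith
  have r10 : μ.real (N ∩ Gy) = q1 + Q23 := by
    have h := measureReal_inter_add_sdiff (μ := μ) (s := N ∩ Gy) (hmeas Zv); rw [sNGZ] at h; linarith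
  have r11 : μ.real N = (q1 + Q23) + (TZ + (tw + tp)) := by
    have h := measureReal_inter_add_sdiff (μ := μ) (s := N) (hmeas Gy); rw [sNT, r10, r6] at h; linarith
  have r12 : μ.real (N ∩ Zv) = q1 + TZ := by
    have h := measureReal_inter_add_sdiff (μ := μ) (s := N ∩ Zv) (hmeas Gy); rw [sNZT] at h; linarith
  have r13 : μ.real D = (b + aZ + (yZu + yzu)) + ((q1 + Q23) + (TZ + (tw + tp))) := by
    have h := measureReal_inter_add_sdiff (μ := μ) (s := D) (hmeas Yv); rw [sDN, r3, r11] at h; linarith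
  have r14 : μ.real (D ∩ Zv) = (b + yZu) + (q1 + TZ) := by
    have h := measureReal_inter_add_sdiff (μ := μ) (s := D ∩ Zv) (hmeas Yv)
    rw [inter_right_comm, sDZN, r4, r12] at h; linarith
  have r15 : μ.real D' = aZ + yzu + tw + tp + Q23 := by
    have h := measureReal_inter_add_sdiff (μ := μ) (s := D) (hmeas Zv); rw [← sD', r13, r14] at h; linarith
  have r16 : μ.real (D' ∩ Yv) = aZ + yzu := by
    have h := measureReal_inter_add_sdiff (μ := μ) (s := D ∩ Yv) (hmeas Zv); rw [← sD'Y, r3, r4] at h; linarith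
  have r17 : μ.real (D' ∩ U) = aZ := by rw [sD'U]
  have r18 : μ.real (D' ∩ Yv ∩ U) = aZ := by rw [sD'YU]
  have r19 : μ.real (D ∩ Zv ∩ U) = b := by rw [sDZU]
  have r20 : μ.real (D' ∩ Zv ∩ U) = 0 := by rw [sD'ZU, measureReal_empty]
  have r21 : μ.real (D' ∩ Zv) = 0 := by rw [sD'Z, measureReal_empty]
  have r22 : μ.real (A' ∩ D' ∩ Wv) = 0 := by rw [sA'W, measureReal_empty]
  -- (G5) BHK Theorem 1.4 with sets: `{s}` repelled from `{y} ∪ X`; `1{s↔z}` versus `1{y↔X}`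
  set G₂ : Set (Sym2 V) → ℝ := fun C => if ∃ x ∈ X, (openGraph C).Reachable y x then 1 else 0 with hG₂
  have hG₂m : Monotone G₂ := by
    refine TripodExchange.predIndicator_monotone ?_
    rintro C C' hCC' ⟨x, hx, hr⟩
    exact ⟨x, hx, hr.mono (openGraph_mono hCC')⟩
  have hF₂ω : ∀ ω : BondConfig V, connIndicatorFn s z (⋃ a ∈ ({s} : Set V), openEdgeCluster ω a) = Zv.indicator 1 ω := by
    intro ω
    have : (⋃ a ∈ ({s} : Set V), openEdgeCluster ω a) = openEdgeCluster ω s := by ext e; simp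
    rw [this, connIndicatorFn_openEdgeCluster]
  have hG₂ω : ∀ ω : BondConfig V, G₂ (⋃ t ∈ insert y X, openEdgeCluster ω t) = Gy.indicator 1 ω := by
    intro ω
    have hiff : (∃ x ∈ X, (openGraph (⋃ t ∈ insert y X, openEdgeCluster ω t)).Reachable y x) ↔
        ∃ x ∈ X, (openGraph ω).Reachable y x := by
      constructor
      · rintro ⟨x, hx, hr⟩
        exact ⟨x, hx, (KNSep.reachable_iff_cluster ω (insert y X) (mem_insert y X) x).2 hr⟩
      · rintro ⟨x, hx, hr⟩
        exact ⟨x, hx, (KNSep.reachable_iff_cluster ω (insert y X) (mem_insert y X) x).1 hr⟩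
    simp only [hG₂, hiff]
    exact TwoSetConditionalAssociation.predIndicator_eq_indicator (fun ω' => ∃ x ∈ X, (openGraph ω').Reachable y x) ω
  have hR0 := BHK2006_twoSetConditionalAssociation.negCorrelation w ({s} : Set V) (insert y X) (connIndicatorFn s z) G₂
    (monotone_connIndicatorFn s z) hG₂m
  simp only [hF₂ω, hG₂ω] at hR0
  change μ.real N * (∫ ω in N, Zv.indicator 1 ω * Gy.indicator 1 ω ∂μ) ≤
    (∫ ω in N, Zv.indicator 1 ω ∂μ) * ∫ ω in N, Gy.indicator 1 ω ∂μ at hR0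
  rw [TripodExchange.setIntegral_indicator_one_eq, TripodExchange.setIntegral_indicator_one_eq,
    TripodExchange.setIntegral_indicator_mul_indicator_eq, sNZG, r11, r12, r10] at hR0
  change ((q1 + Q23) + (TZ + (tw + tp))) * q1 ≤ (q1 + TZ) * (q1 + Q23) at hR0
  -- further splits for the `M₁` certificate
  have sDU : D ∩ U = D ∩ Yv ∩ U := by
    ext ω; simp only [mem_inter_iff]
    constructor
    · rintro ⟨hd, hu⟩; exact ⟨⟨hd, hUY ω hu⟩, hu⟩
    · rintro ⟨⟨hd, -⟩, hu⟩; exact ⟨hd, hu⟩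
  have sE₁uY : (A₀ ∩ D) \ U ∩ Yv = (D ∩ Yv) \ U := by
    ext ω; simp only [mem_inter_iff, mem_sdiff, mA₀, mD, mY]
    constructor
    · rintro ⟨⟨⟨-, hd⟩, hu⟩, hy⟩; exact ⟨⟨hd, hy⟩, hu⟩
    · rintro ⟨⟨hd, hy⟩, hu⟩; exact ⟨⟨⟨fun x hx hyx => hd x hx (hy.trans hyx), hd⟩, hu⟩, hy⟩
  have sE₁uN : ((A₀ ∩ D) \ U) \ Yv = A ∩ D := by
    ext ω; simp only [mem_inter_iff, mem_sdiff, mA₀, mD, mA, mY]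
    constructor
    · rintro ⟨⟨⟨ha, hd⟩, -⟩, hy⟩; exact ⟨⟨fun h => hy h.symm, ha⟩, hd⟩
    · rintro ⟨⟨hys, ha⟩, hd⟩; exact ⟨⟨⟨ha, hd⟩, fun hu => hys (hUY ω hu).symm⟩, fun h => hys h.symm⟩
  have sMcY : (((A₀ ∩ D) \ U) \ Zv) \ Wv ∩ Yv = ((D ∩ Yv) \ U) \ Zv := by
    ext ω; simp only [mem_inter_iff, mem_sdiff, mA₀, mD, mY, mZ, mW]
    constructor
    · rintro ⟨⟨⟨⟨⟨-, hd⟩, hu⟩, hz⟩, -⟩, hy⟩; exact ⟨⟨⟨hd, hy⟩, hu⟩, hz⟩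
    · rintro ⟨⟨⟨hd, hy⟩, hu⟩, hz⟩
      exact ⟨⟨⟨⟨⟨fun x hx hyx => hd x hx (hy.trans hyx), hd⟩, hu⟩, hz⟩, fun hyz => hz (hy.trans hyz)⟩, hy⟩
  have sMcN : ((((A₀ ∩ D) \ U) \ Zv) \ Wv) \ Yv = A' ∩ D' := by
    ext ω; simp only [mem_inter_iff, mem_sdiff, mA₀, mD, mA', mD', mY, mZ, mW]
    constructor
    · rintro ⟨⟨⟨⟨⟨ha, hd⟩, -⟩, hz⟩, hw⟩, hy⟩; exact ⟨⟨fun h => hy h.symm, hw, ha⟩, hz, hd⟩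
    · rintro ⟨⟨hys, hw, ha⟩, hz, hd⟩
      exact ⟨⟨⟨⟨⟨ha, hd⟩, fun hu => hys (hUY ω hu).symm⟩, hz⟩, hw⟩, fun h => hys h.symm⟩
  have sDZuY : (D ∩ Zv) \ U ∩ Yv = ((D ∩ Yv) \ U) ∩ Zv := by
    ext ω; simp only [mem_inter_iff, mem_sdiff]; tauto
  have sDZuN : ((D ∩ Zv) \ U) \ Yv = N ∩ Zv := by
    ext ω; simp only [mem_inter_iff, mem_sdiff, mD, mN, mY, mZ]
    constructor
    · rintro ⟨⟨⟨hd, hz⟩, -⟩, hy⟩; exact ⟨⟨hy, hd⟩, hz⟩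
    · rintro ⟨⟨hy, hd⟩, hz⟩; exact ⟨⟨⟨hd, hz⟩, fun hu => hy (hUY ω hu)⟩, hy⟩
  have sDzuY : (D \ Zv) \ U ∩ Yv = ((D ∩ Yv) \ U) \ Zv := by
    ext ω; simp only [mem_inter_iff, mem_sdiff]; tauto
  have sDzuN : ((D \ Zv) \ U) \ Yv = N \ Zv := by
    ext ω; simp only [mem_sdiff, mD, mN, mY, mZ]
    constructor
    · rintro ⟨⟨⟨hd, hz⟩, -⟩, hy⟩; exact ⟨⟨hy, hd⟩, hz⟩
    · rintro ⟨⟨hy, hd⟩, hz⟩; exact ⟨⟨⟨hd, hz⟩, fun hu => hy (hUY ω hu)⟩, hy⟩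
  have r23 : μ.real (D ∩ U) = b + aZ := by rw [sDU, r1]
  have r24 : μ.real ((A₀ ∩ D) \ U) = (yZu + yzu) + (TZ + (tw + tp)) := by
    have h := measureReal_inter_add_sdiff (μ := μ) (s := (A₀ ∩ D) \ U) (hmeas Yv)
    rw [sE₁uY, sE₁uN, r2, r6] at h; linarith
  have r25 : μ.real ((((A₀ ∩ D) \ U) \ Zv) \ Wv) = yzu + tp := by
    have h := measureReal_inter_add_sdiff (μ := μ) (s := (((A₀ ∩ D) \ U) \ Zv) \ Wv) (hmeas Yv)
    rw [sMcY, sMcN] at h; linarith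
  have r26 : μ.real ((D ∩ Zv) \ U) = yZu + (q1 + TZ) := by
    have h := measureReal_inter_add_sdiff (μ := μ) (s := (D ∩ Zv) \ U) (hmeas Yv)
    rw [sDZuY, sDZuN, r12] at h; linarith
  have r27 : μ.real (N \ Zv) = Q23 + (tw + tp) := by
    have h := measureReal_inter_add_sdiff (μ := μ) (s := N) (hmeas Zv); rw [r11, r12] at h; linarith
  have r28 : μ.real ((D \ Zv) \ U) = yzu + (Q23 + (tw + tp)) := by
    have h := measureReal_inter_add_sdiff (μ := μ) (s := (D \ Zv) \ U) (hmeas Yv)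
    rw [sDzuY, sDzuN, r27] at h; linarith
  -- the exchange hypotheses in atoms
  change aZ * μ.real (A ∩ D) ≤ tp * μ.real (D ∩ Yv ∩ U) at hGa
  rw [r6, r1] at hGa
  change aZ * μ.real ((A₀ ∩ D) \ U) ≤ μ.real ((((A₀ ∩ D) \ U) \ Zv) \ Wv) * μ.real (D ∩ Yv ∩ U) at hGc
  rw [r24, r25, r1] at hGc
  change aZ * μ.real ((D ∩ Zv) \ U) ≤ μ.real ((D \ Zv) \ U) * b at hGe
  rw [r26, r28] at hGe
  -- the member in atoms
  unfold polMargin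
  rw [hI, hI, hI, hI, hI, hI, r22, r21, r20, r19, r23, r17, r1, r18, r13, r14, r15, r3, r16, r6]
  have e := markerPinned_M1_algebra b aZ yZu yzu TZ tw tp q1 Q23
  have hQ23 : 0 ≤ Q23 := h0 _; have htw0 : 0 ≤ tw := h0 _; have htp0 : 0 ≤ tp := h0 _
  have haZ0 : 0 ≤ aZ := h0 _; have hTZ0 : 0 ≤ TZ := h0 _
  have p1 : 0 ≤ (2 * Q23 + tw) * (tp * (b + aZ) - aZ * (TZ + tw + tp)) :=
    mul_nonneg (by linarith only [hQ23, htw0]) (by linarith only [hGa])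
  have p2 : 0 ≤ (2 * tp + tw) * ((yzu + tp) * (b + aZ) - aZ * (yZu + yzu + TZ + tw + tp)) :=
    mul_nonneg (by linarith only [htp0, htw0]) (by linarith only [hGc])
  have p3 : 0 ≤ 2 * aZ * (TZ * (TZ + tw + tp + q1 + Q23) - (TZ + q1) * (TZ + tw + tp)) :=
    mul_nonneg (by linarith only [haZ0]) (by linarith only [hR0])
  have p4 : 0 ≤ TZ * ((yzu + tw + tp + Q23) * b - aZ * (yZu + TZ + q1)) := mul_nonneg hTZ0 (by linarith only [hGe])
  linarith only [e, p1, p2, p3, p4]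

end Consts

end Summit.CriticalPhenomena.PercolationContinuityZ3.Theorems

end
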